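import Literature.Probability.LatticeModels.IsingLaceNesting
import Literature.Probability.LatticeModels.IsingLaceSecondConditioning
import HarnessLib

/-!
# Proof of Sakai's second-expansion identity (2.35): `Sakai2007_secondExpansion_holds`

Topic `Probability/LatticeModels`, grouping namespace `IsingLace`. This file discharges the named
fact `IsingLace.Sakai2007_secondExpansion` of `IsingLaceNesting.lean` — the identity (2.35) of
A. Sakai, *Lace expansion for the Ising model*, §2.2.2, for the Ising model with uniform
ferromagnetic coupling `β ≥ 0` on a finite simple graph and every `(𝒜, v, x)`:

`⟨φ_vφ_x⟩_Λ - ⟨φ_vφ_x⟩_{𝒜ᶜ} = Θ_{v,x;𝒜} + Σ_b Θ_{v,b̲;𝒜} τ_b ⟨φ_{b̄}φ_x⟩_Λ - Σ_b Θ_{v,b̲;𝒜}[τ_b (⟨φ_{b̄}φ_x⟩_Λ - ⟨φ_{b̄}φ_x⟩_{𝒞^b(v)ᶜ})]`,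

along the printed route: Proposition 2.2 (the tree's `twoPoint_sub_twoPointOff_eq_tsum`), the
decomposition (2.29) of `1{v ⟷ x through 𝒜}` by the first pivotal bond through `𝒜`
(`IsingLaceThroughPivotal.lean`), the parities and the `tanh` flip (2.31)
(`IsingLaceSecondParity.lean`), the conditioning on `𝒞^b_{m+n}(v) = ℬ` with the decoupling of the
bonds off `ℬ` (2.32)–(2.33) (`IsingLaceSecondConditioning.lean`), and the removal of "off `b`" and
of the parity constraints (2.34) (`indicator_drop₂`). The assembly is carried out for the
unnormalised sums in `ℝ≥0∞` (`tsum_pair_connThrough_eq`, `tsum_pair_isFirstThrough_eq_theta`),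
converted to the real, `(Z_{𝒜ᶜ} Z_Λ)`-normalised form of Sakai's `Θ` (`secondExpansion'`, which is
(2.35) with the last two sums merged: `… = Θ_{v,x;𝒜} + Σ_b Θ_{v,b̲;𝒜}[τ_b ⟨φ_b̄φ_x⟩_{𝒞^b(v)ᶜ}]`),
and finally split by the linearity of `Θ` (`IsingLaceTheta.lean`) into the printed three-term form
`SecondExpansionAt`. With `Sakai2007_prop11_of_secondExpansion` of `IsingLaceNesting.lean` this also
yields Proposition 1.1 unconditionally (`Sakai2007_prop11_holds`).

## References

* A. Sakai, *Lace expansion for the Ising model*, Comm. Math. Phys. 272 (2007) 283–344,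
  arXiv:math-ph/0510093: §2.2.2, (2.28)–(2.35) [Sakai2007].
* A. Sakai, *Correct bounds on the Ising lace-expansion coefficients*, Comm. Math. Phys. 392
  (2022) 783–823, arXiv:2003.09856: §2.5 [Sakai2022].
(Equation numbers are those of the arXiv versions held in the literature store, every display
counted.)
-/

noncomputable section

open Finset
open scoped symmDiff ENNReal BigOperators

namespace Literature.Probability.LatticeModels

variable {V : Type*} [Fintype V] [DecidableEq V] {G : SimpleGraph V} [DecidableRel G.Adj]

namespace IsingLace

/-! ## (2.29) for the weighted pair sums, and the `b`-summand in `Θ`-form -/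

open Classical in
/-- (2.29) in `ℝ≥0∞`, weighted by `w(n) 1{∂n = v △ x}`:
`w(n) 1{v ⟷_{m+n} x through 𝒜} = w(n) 1{E_{m+n}(v,x;𝒜)} + Σ_b w(n) 1{b qualifies for m+n}`.
[cite: Sakai2007, (2.29)] -/
theorem indicator_split₂ (β : ℝ) (A : Finset V) (v x : V) (m n : Current G) :
    (if n.sources = ({v} : Finset V) ∆ {x} then ENNReal.ofReal (n.weight β) else 0) *
        (if ConnThrough G (m + n) A v x then (1 : ℝ≥0∞) else 0) =
      (if n.sources = ({v} : Finset V) ∆ {x} ∧ laceEvent G (m + n) A v x then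
          ENNReal.ofReal (n.weight β) else 0) +
        ∑ d : G.Dart, (if n.sources = ({v} : Finset V) ∆ {x} ∧ IsFirstThrough G (m + n) A v x d then
          ENNReal.ofReal (n.weight β) else 0) := by
  by_cases hs : n.sources = ({v} : Finset V) ∆ {x}
  · have hreal := indicator_connThrough_eq (G := G) (m + n) A v x
    have hE : (if ConnThrough G (m + n) A v x then (1 : ℝ≥0∞) else 0) =
        (if laceEvent G (m + n) A v x then (1 : ℝ≥0∞) else 0) +
          ∑ d : G.Dart, (if IsFirstThrough G (m + n) A v x d then (1 : ℝ≥0∞) else 0) := by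
      have h := congrArg ENNReal.ofReal hreal
      rw [ENNReal.ofReal_add (by positivity) (Finset.sum_nonneg fun d _ => by positivity),
        ENNReal.ofReal_sum_of_nonneg (fun d _ => by positivity)] at h
      simpa only [apply_ite ENNReal.ofReal, ENNReal.ofReal_one, ENNReal.ofReal_zero] using h
    rw [if_pos hs, hE, mul_add, Finset.mul_sum, mul_ite, mul_one, mul_zero]
    congr 1
    · exact if_congr ⟨fun h => ⟨hs, h⟩, fun h => h.2⟩ rfl rfl
    · refine Finset.sum_congr rfl fun d _ => ?_
      rw [mul_ite, mul_one, mul_zero]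
      exact if_congr ⟨fun h => ⟨hs, h⟩, fun h => h.2⟩ rfl rfl
  · rw [if_neg hs, zero_mul, if_neg (fun h => hs h.1),
      Finset.sum_eq_zero (fun d _ => if_neg (fun h => hs h.1)), add_zero]

open Classical in
/-- **(2.29) summed against the weights of `Θ`** (unnormalised, `ℝ≥0∞`):
`Σ_{(m,n)} w_{𝒜ᶜ}(m) w(n) 1{∂n = v△x} 1{v ⟷ x through 𝒜} = Σ (…) 1{E_{m+n}(v,x;𝒜)} + Σ_b Σ (…) 1{b qualifies}`.
[cite: Sakai2007, (2.29)–(2.30)] -/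
theorem tsum_pair_connThrough_eq (β : ℝ) (A : Finset V) (v x : V) :
    ∑' p : Current G × Current G,
        (if Current.IsSupp (offGraph G A) p.1 ∧ p.1.sources = ∅ then ENNReal.ofReal (p.1.weight β) else 0) *
          (if p.2.sources = ({v} : Finset V) ∆ {x} then ENNReal.ofReal (p.2.weight β) else 0) *
          (if ConnThrough G (p.1 + p.2) A v x then (1 : ℝ≥0∞) else 0) =
      (∑' p : Current G × Current G,
        (if Current.IsSupp (offGraph G A) p.1 ∧ p.1.sources = ∅ then ENNReal.ofReal (p.1.weight β) else 0) *
          (if p.2.sources = ({v} : Finset V) ∆ {x} ∧ laceEvent G (p.1 + p.2) A v x then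
            ENNReal.ofReal (p.2.weight β) else 0)) +
        ∑ d : G.Dart, ∑' p : Current G × Current G,
          (if Current.IsSupp (offGraph G A) p.1 ∧ p.1.sources = ∅ then ENNReal.ofReal (p.1.weight β) else 0) *
            (if p.2.sources = ({v} : Finset V) ∆ {x} ∧ IsFirstThrough G (p.1 + p.2) A v x d then
              ENNReal.ofReal (p.2.weight β) else 0) := by
  have h : ∀ p : Current G × Current G,
      (if Current.IsSupp (offGraph G A) p.1 ∧ p.1.sources = ∅ then ENNReal.ofReal (p.1.weight β) else 0) *
          (if p.2.sources = ({v} : Finset V) ∆ {x} then ENNReal.ofReal (p.2.weight β) else 0) *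
          (if ConnThrough G (p.1 + p.2) A v x then (1 : ℝ≥0∞) else 0) =
        (if Current.IsSupp (offGraph G A) p.1 ∧ p.1.sources = ∅ then ENNReal.ofReal (p.1.weight β) else 0) *
            (if p.2.sources = ({v} : Finset V) ∆ {x} ∧ laceEvent G (p.1 + p.2) A v x then
              ENNReal.ofReal (p.2.weight β) else 0) +
          ∑ d : G.Dart,
            (if Current.IsSupp (offGraph G A) p.1 ∧ p.1.sources = ∅ then ENNReal.ofReal (p.1.weight β) else 0) *
              (if p.2.sources = ({v} : Finset V) ∆ {x} ∧ IsFirstThrough G (p.1 + p.2) A v x d then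
                ENNReal.ofReal (p.2.weight β) else 0) := fun p => by
    rw [mul_assoc, indicator_split₂ β A v x p.1 p.2, mul_add, Finset.mul_sum]
  rw [tsum_congr h, ENNReal.tsum_add, Summable.tsum_finsetSum (fun d _ => ENNReal.summable)]

open Classical in
/-- **The `b`-summand of (2.35), unnormalised** ((2.29) → (2.34) for one directed bond `b`):
`Σ_{(m,n)} w_{𝒜ᶜ}(m) w(n) 1{∂n = v△x} 1{b qualifies for m+n}`
`= tanh β · Σ_{(m,n)} w_{𝒜ᶜ}(m) w(n) 1{∂n = v△b̲} 1{E_{m+n}(v,b̲;𝒜)} ⟨φ_b̄ φ_x⟩_{𝒞^b_{m+n}(v)ᶜ}`.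
[cite: Sakai2007, (2.29)–(2.34)] -/
theorem tsum_pair_isFirstThrough_eq_theta {β : ℝ} (hβ : 0 ≤ β) (A : Finset V) (v x : V) (d : G.Dart) :
    ∑' p : Current G × Current G,
        (if Current.IsSupp (offGraph G A) p.1 ∧ p.1.sources = ∅ then ENNReal.ofReal (p.1.weight β) else 0) *
          (if p.2.sources = ({v} : Finset V) ∆ {x} ∧ IsFirstThrough G (p.1 + p.2) A v x d then
            ENNReal.ofReal (p.2.weight β) else 0) =
      ENNReal.ofReal (Real.tanh β) * ∑' p : Current G × Current G,
        (if Current.IsSupp (offGraph G A) p.1 ∧ p.1.sources = ∅ then ENNReal.ofReal (p.1.weight β) else 0) *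
          (if p.2.sources = ({v} : Finset V) ∆ {d.fst} ∧ laceEvent G (p.1 + p.2) A v d.fst then
            ENNReal.ofReal (p.2.weight β) *
              ENNReal.ofReal (twoPointOff G β (clusterOff G (p.1 + p.2) (dartEdge G d) v) d.snd x)
            else 0) := by
  rw [tsum_pair_isFirstThrough_eq hβ A v x d, tsum_pair_conditioning hβ A v x d]
  congr 1
  refine tsum_congr fun p => ?_
  by_cases hm : Current.IsSupp (offGraph G A) p.1 ∧ p.1.sources = ∅
  · rw [if_pos hm]
    congr 1
    by_cases hsn : p.2.sources = ({v} : Finset V) ∆ {d.fst}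
    · simp only [hsn, true_and]
      exact indicator_drop₂ β A x (ENNReal.ofReal (p.2.weight β)) hm.2 hsn
    · rw [if_neg (fun h => hsn h.1), if_neg (fun h => hsn h.1)]
  · rw [if_neg hm, zero_mul, zero_mul]

/-! ## Back to real numbers -/

/-- Pulling the normalisation `(Z_{𝒜ᶜ} Z_Λ)⁻¹` out of the pair sums defining `Θ` and Proposition 2.2.
[folklore] -/
theorem tsum_norm_eq (β : ℝ) (A B : Finset V) (Φ : Current G × Current G → ℝ) :
    ∑' p : Current G × Current G,
        (if Current.IsSupp (offGraph G A) p.1 ∧ p.1.sources = ∅ then p.1.weight β / zOff G β A else 0) *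
          (if p.2.sources = B then p.2.weight β / zOff G β ∅ else 0) * Φ p =
      (zOff G β A * zOff G β ∅)⁻¹ * ∑' p : Current G × Current G,
        (if Current.IsSupp (offGraph G A) p.1 ∧ p.1.sources = ∅ then p.1.weight β else 0) *
          (if p.2.sources = B then p.2.weight β else 0) * Φ p := by
  rw [← tsum_mul_left]
  refine tsum_congr fun p => ?_
  split_ifs <;> ring

/-- `ofReal` of the unnormalised real pair sums with a factor `Φ ∈ [0, 1]` is the `ℝ≥0∞` pair sum
(absolute convergence, `summable_offPair_mul`; `β ≥ 0`). [folklore] -/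
theorem ofReal_tsum_pair {β : ℝ} (hβ : 0 ≤ β) (A B : Finset V) {Φ : Current G × Current G → ℝ}
    (h0 : ∀ p, 0 ≤ Φ p) (h1 : ∀ p, Φ p ≤ 1) :
    ENNReal.ofReal (∑' p : Current G × Current G,
        (if Current.IsSupp (offGraph G A) p.1 ∧ p.1.sources = ∅ then p.1.weight β else 0) *
          (if p.2.sources = B then p.2.weight β else 0) * Φ p) =
      ∑' p : Current G × Current G,
        (if Current.IsSupp (offGraph G A) p.1 ∧ p.1.sources = ∅ then ENNReal.ofReal (p.1.weight β) else 0) *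
          (if p.2.sources = B then ENNReal.ofReal (p.2.weight β) else 0) * ENNReal.ofReal (Φ p) := by
  classical
  have hs := summable_offPair_mul (G := G) β A B (Φ := Φ) (C := 1)
    (fun p => by rw [abs_of_nonneg (h0 p)]; exact h1 p)
  have ha : ∀ p : Current G × Current G,
      0 ≤ (if Current.IsSupp (offGraph G A) p.1 ∧ p.1.sources = ∅ then p.1.weight β else 0) := fun p => by
    split_ifs
    · exact Current.weight_nonneg hβ _
    · exact le_rfl
  have hb : ∀ p : Current G × Current G, 0 ≤ (if p.2.sources = B then p.2.weight β else 0) := fun p => by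
    split_ifs
    · exact Current.weight_nonneg hβ _
    · exact le_rfl
  rw [ENNReal.ofReal_tsum_of_nonneg (fun p => mul_nonneg (mul_nonneg (ha p) (hb p)) (h0 p)) hs]
  refine tsum_congr fun p => ?_
  rw [ENNReal.ofReal_mul (mul_nonneg (ha p) (hb p)), ENNReal.ofReal_mul (ha p), ofReal_ite, ofReal_ite]

/-- The unnormalised real pair sums are nonnegative (`β ≥ 0`, `Φ ≥ 0`). [folklore] -/
theorem tsum_pair_nonneg {β : ℝ} (hβ : 0 ≤ β) (A B : Finset V) {Φ : Current G × Current G → ℝ}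
    (h0 : ∀ p, 0 ≤ Φ p) :
    0 ≤ ∑' p : Current G × Current G,
        (if Current.IsSupp (offGraph G A) p.1 ∧ p.1.sources = ∅ then p.1.weight β else 0) *
          (if p.2.sources = B then p.2.weight β else 0) * Φ p := by
  refine tsum_nonneg fun p => mul_nonneg (mul_nonneg ?_ ?_) (h0 p)
  · split_ifs
    · exact Current.weight_nonneg hβ _
    · exact le_rfl
  · split_ifs
    · exact Current.weight_nonneg hβ _
    · exact le_rfl

/-! ## The second expansion -/

open Classical in
/-- **Sakai 2007, (2.35) with the last two sums merged**: for `β ≥ 0` and all `𝒜`, `v`, `x`,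
`⟨φ_vφ_x⟩_Λ - ⟨φ_vφ_x⟩_{𝒜ᶜ} = Θ_{v,x;𝒜} + Σ_b Θ_{v,b̲;𝒜}[τ_b ⟨φ_b̄ φ_x⟩_{𝒞^b(v)ᶜ}]`
((2.30)–(2.34) substituted into Proposition 2.2). [cite: Sakai2007, (2.30)–(2.35)] -/
theorem secondExpansion' {β : ℝ} (hβ : 0 ≤ β) (A : Finset V) (v x : V) :
    isingTwoPoint G univ β 0 .free v x - twoPointOff G β A v x =
      theta G β A v x (fun _ => 1) + ∑ d : G.Dart, theta G β A v d.fst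
        (fun N => Real.tanh β * twoPointOff G β (clusterOff G N (dartEdge G d) v) d.snd x) := by
  classical
  have hτ0 : 0 ≤ Real.tanh β := tanh_nonneg_of_nonneg hβ
  have hτ1 : Real.tanh β ≤ 1 := (le_abs_self _).trans (abs_tanh_le_one β)
  -- the three real pair sums (unnormalised)
  set L : ℝ := ∑' p : Current G × Current G,
    (if Current.IsSupp (offGraph G A) p.1 ∧ p.1.sources = ∅ then p.1.weight β else 0) *
      (if p.2.sources = ({v} : Finset V) ∆ {x} then p.2.weight β else 0) *
      (if ConnThrough G (p.1 + p.2) A v x then (1 : ℝ) else 0) with hL_def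
  set E : ℝ := ∑' p : Current G × Current G,
    (if Current.IsSupp (offGraph G A) p.1 ∧ p.1.sources = ∅ then p.1.weight β else 0) *
      (if p.2.sources = ({v} : Finset V) ∆ {x} then p.2.weight β else 0) *
      (if laceEvent G (p.1 + p.2) A v x then (1 : ℝ) else 0) with hE_def
  set F : G.Dart → ℝ := fun d => ∑' p : Current G × Current G,
    (if Current.IsSupp (offGraph G A) p.1 ∧ p.1.sources = ∅ then p.1.weight β else 0) *
      (if p.2.sources = ({v} : Finset V) ∆ {d.fst} then p.2.weight β else 0) *
      (if laceEvent G (p.1 + p.2) A v d.fst then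
        Real.tanh β * twoPointOff G β (clusterOff G (p.1 + p.2) (dartEdge G d) v) d.snd x else 0) with hF_def
  -- bounds on the factors
  have hCT0 : ∀ p : Current G × Current G, 0 ≤ (if ConnThrough G (p.1 + p.2) A v x then (1 : ℝ) else 0) :=
    fun p => by positivity
  have hCT1 : ∀ p : Current G × Current G, (if ConnThrough G (p.1 + p.2) A v x then (1 : ℝ) else 0) ≤ 1 :=
    fun p => by split_ifs <;> norm_num
  have hLE0 : ∀ (y : V) (p : Current G × Current G), 0 ≤ (if laceEvent G (p.1 + p.2) A v y then (1 : ℝ) else 0) :=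
    fun y p => by positivity
  have hLE1 : ∀ (y : V) (p : Current G × Current G), (if laceEvent G (p.1 + p.2) A v y then (1 : ℝ) else 0) ≤ 1 :=
    fun y p => by split_ifs <;> norm_num
  have hF0 : ∀ (d : G.Dart) (p : Current G × Current G), 0 ≤ (if laceEvent G (p.1 + p.2) A v d.fst then
      Real.tanh β * twoPointOff G β (clusterOff G (p.1 + p.2) (dartEdge G d) v) d.snd x else 0) :=
    fun d p => by
      split_ifs
      · exact mul_nonneg hτ0 (twoPointOff_nonneg hβ _ _ _)
      · exact le_rfl
  have hF1 : ∀ (d : G.Dart) (p : Current G × Current G), (if laceEvent G (p.1 + p.2) A v d.fst then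
      Real.tanh β * twoPointOff G β (clusterOff G (p.1 + p.2) (dartEdge G d) v) d.snd x else 0) ≤ 1 :=
    fun d p => by
      split_ifs
      · exact mul_le_one₀ hτ1 (twoPointOff_nonneg hβ _ _ _)
          ((le_abs_self _).trans (abs_twoPointOff_le_one β _ _ _))
      · exact zero_le_one
  -- the identity for the unnormalised sums, from the `ℝ≥0∞` computation
  have key : L = E + ∑ d : G.Dart, F d := by
    have hLe : ENNReal.ofReal L = ∑' p : Current G × Current G,
        (if Current.IsSupp (offGraph G A) p.1 ∧ p.1.sources = ∅ then ENNReal.ofReal (p.1.weight β) else 0) *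
          (if p.2.sources = ({v} : Finset V) ∆ {x} then ENNReal.ofReal (p.2.weight β) else 0) *
          (if ConnThrough G (p.1 + p.2) A v x then (1 : ℝ≥0∞) else 0) := by
      rw [hL_def, ofReal_tsum_pair hβ A _ hCT0 hCT1]
      refine tsum_congr fun p => ?_
      rw [ofReal_ite, ENNReal.ofReal_one]
    have hEe : ENNReal.ofReal E = ∑' p : Current G × Current G,
        (if Current.IsSupp (offGraph G A) p.1 ∧ p.1.sources = ∅ then ENNReal.ofReal (p.1.weight β) else 0) *
          (if p.2.sources = ({v} : Finset V) ∆ {x} ∧ laceEvent G (p.1 + p.2) A v x then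
            ENNReal.ofReal (p.2.weight β) else 0) := by
      rw [hE_def, ofReal_tsum_pair hβ A _ (hLE0 x) (hLE1 x)]
      refine tsum_congr fun p => ?_
      rw [ofReal_ite, ENNReal.ofReal_one, mul_assoc, ite_zero_mul_ite_zero, mul_one]
    have hFe : ∀ d : G.Dart, ENNReal.ofReal (F d) = ENNReal.ofReal (Real.tanh β) *
        ∑' p : Current G × Current G,
          (if Current.IsSupp (offGraph G A) p.1 ∧ p.1.sources = ∅ then ENNReal.ofReal (p.1.weight β) else 0) *
            (if p.2.sources = ({v} : Finset V) ∆ {d.fst} ∧ laceEvent G (p.1 + p.2) A v d.fst then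
              ENNReal.ofReal (p.2.weight β) *
                ENNReal.ofReal (twoPointOff G β (clusterOff G (p.1 + p.2) (dartEdge G d) v) d.snd x)
              else 0) := by
      intro d
      rw [hF_def]
      dsimp only
      rw [ofReal_tsum_pair hβ A _ (hF0 d) (hF1 d), ← ENNReal.tsum_mul_left]
      refine tsum_congr fun p => ?_
      rw [ofReal_ite, ENNReal.ofReal_mul hτ0]
      by_cases hsu : p.2.sources = ({v} : Finset V) ∆ {d.fst}
      · by_cases hl : laceEvent G (p.1 + p.2) A v d.fst
        · rw [if_pos hsu, if_pos hl,
            if_pos (show p.2.sources = ({v} : Finset V) ∆ {d.fst} ∧ laceEvent G (p.1 + p.2) A v d.fst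
              from ⟨hsu, hl⟩)]
          ring
        · rw [if_pos hsu, if_neg hl,
            if_neg (show ¬(p.2.sources = ({v} : Finset V) ∆ {d.fst} ∧ laceEvent G (p.1 + p.2) A v d.fst)
              from fun h => hl h.2), mul_zero, mul_zero, mul_zero]
      · rw [if_neg hsu, mul_zero, zero_mul,
          if_neg (show ¬(p.2.sources = ({v} : Finset V) ∆ {d.fst} ∧ laceEvent G (p.1 + p.2) A v d.fst)
            from fun h => hsu h.1), mul_zero, mul_zero]
    have hE0 : 0 ≤ E := tsum_pair_nonneg hβ A _ (hLE0 x)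
    have hFn : ∀ d, 0 ≤ F d := fun d => tsum_pair_nonneg hβ A _ (hF0 d)
    refine (ENNReal.ofReal_eq_ofReal_iff (tsum_pair_nonneg hβ A _ hCT0)
      (add_nonneg hE0 (Finset.sum_nonneg fun d _ => hFn d))).1 ?_
    rw [ENNReal.ofReal_add hE0 (Finset.sum_nonneg fun d _ => hFn d),
      ENNReal.ofReal_sum_of_nonneg (fun d _ => hFn d), hLe, hEe, tsum_pair_connThrough_eq β A v x]
    congr 1
    refine Finset.sum_congr rfl fun d _ => ?_
    rw [hFe d, tsum_pair_isFirstThrough_eq_theta hβ A v x d]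
  -- normalisation
  have h22 : isingTwoPoint G univ β 0 .free v x - twoPointOff G β A v x = (zOff G β A * zOff G β ∅)⁻¹ * L := by
    rw [twoPoint_sub_twoPointOff_eq_tsum, hL_def, ← tsum_norm_eq]
  have hth : ∀ (y : V) (X : Current G → ℝ), theta G β A v y X = (zOff G β A * zOff G β ∅)⁻¹ *
      ∑' p : Current G × Current G,
        (if Current.IsSupp (offGraph G A) p.1 ∧ p.1.sources = ∅ then p.1.weight β else 0) *
          (if p.2.sources = ({v} : Finset V) ∆ {y} then p.2.weight β else 0) *
          (if laceEvent G (p.1 + p.2) A v y then X (p.1 + p.2) else 0) := by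
    intro y X
    rw [theta_eq_tsum, ← tsum_norm_eq]
    rfl
  rw [h22, hth, Finset.sum_congr rfl fun d _ => hth d.fst _, key, mul_add, Finset.mul_sum]

/-- **Sakai 2007, the second expansion (2.35)** for the uniform ferromagnetic coupling `β ≥ 0` on
a finite graph: the statement `SecondExpansionAt G β` — the merged form `secondExpansion'` split by
the linearity of `Θ` (`Θ[τ_b ⟨⟩_{𝒞ᶜ}] = Θ[1] τ_b ⟨⟩_Λ - Θ[τ_b(⟨⟩_Λ - ⟨⟩_{𝒞ᶜ})]`).
[cite: Sakai2007, (2.35)] -/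
theorem secondExpansionAt {β : ℝ} (hβ : 0 ≤ β) : SecondExpansionAt G β := by
  classical
  intro A v x
  have hτ0 : 0 ≤ Real.tanh β := tanh_nonneg_of_nonneg hβ
  -- the observables of the `b`-terms
  set T : G.Dart → ℝ := fun d => isingTwoPoint G univ β 0 .free d.snd x with hT
  have hT1 : ∀ d, |T d| ≤ 1 := fun d => abs_isingTwoPoint_le_one _ _ _ _ _ _ _
  have hXb : ∀ (d : G.Dart) (N : Current G), |Real.tanh β * T d| ≤ |Real.tanh β| := fun d N => by
    rw [abs_mul]
    exact mul_le_of_le_one_right (abs_nonneg _) (hT1 d)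
  have hYb : ∀ (d : G.Dart) (N : Current G),
      |Real.tanh β * (T d - twoPointOff G β (clusterOff G N (dartEdge G d) v) d.snd x)| ≤ |Real.tanh β| * 2 :=
    fun d N => by
      rw [abs_mul]
      refine mul_le_mul_of_nonneg_left ((abs_sub _ _).trans ?_) (abs_nonneg _)
      have := abs_twoPointOff_le_one (G := G) β (clusterOff G N (dartEdge G d) v) d.snd x
      linarith [hT1 d]
  have hthetaX : ∀ d : G.Dart, theta G β A v d.fst (fun _ => Real.tanh β * T d) =
      theta G β A v d.fst (fun _ => 1) * Real.tanh β * T d := fun d => by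
    rw [theta_const]; ring
  have hsub : ∀ d : G.Dart, theta G β A v d.fst (fun _ => Real.tanh β * T d) -
      theta G β A v d.fst (fun N => Real.tanh β * (T d - twoPointOff G β (clusterOff G N (dartEdge G d) v) d.snd x)) =
      theta G β A v d.fst
        (fun N => Real.tanh β * twoPointOff G β (clusterOff G N (dartEdge G d) v) d.snd x) := fun d => by
    rw [← theta_sub (β := β) (A := A) (v := v) (x := d.fst) ⟨_, hXb d⟩ ⟨_, hYb d⟩]
    congr 1
    funext N
    ring
  rw [secondExpansion' hβ A v x, add_sub_assoc, ← Finset.sum_sub_distrib]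
  congr 1
  refine Finset.sum_congr rfl fun d _ => ?_
  rw [← hthetaX d, hsub d]

/-- **Discharge of the named fact `Sakai2007_secondExpansion`** (Sakai 2007, (2.35), for the Ising
model with uniform ferromagnetic coupling `β ≥ 0` on a finite simple graph and every `(𝒜, v, x)`).
[cite: Sakai2007, §2.2.2, (2.28)–(2.35)] -/
theorem Sakai2007_secondExpansion_holds : Sakai2007_secondExpansion :=
  fun _V _ _ _G _ _β hβ => secondExpansionAt hβ

/-- **Sakai 2007, Proposition 1.1 with the bounds (1.13)**, now unconditional: the tree's reduction
`Sakai2007_prop11_of_secondExpansion` fed with `Sakai2007_secondExpansion_holds`.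
[cite: Sakai2007, Proposition 1.1 and §2.2] -/
theorem Sakai2007_prop11_holds : Sakai2007_prop11 :=
  Sakai2007_prop11_of_secondExpansion Sakai2007_secondExpansion_holds

end IsingLace

end Literature.Probability.LatticeModels

end
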